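import Literature.NumberTheory.Automorphic.AutomorphicQuotientKernel
import HarnessLib

/-!
# The kernel of `R(F)` for integrable test functions `F ∈ L¹(G)` (a.e. form), and the unfolding of
`∫_G F(g) ⟨φ', R(g) φ⟩ dg`

Topic `NumberTheory/Automorphic`; proof file (theorems only) extending `AutomorphicQuotientKernel`
(the kernel `K_f(x̃, ỹH) = ∫_H f(x̃ h⁻¹ ỹ⁻¹) dρ(h)` of `R(f)` on `L²(G ⧸ H)` for `f ∈ C_c(G)`) to
**integrable** test functions `F ∈ L¹(G, ν)`, as needed for the global zeta integrals of
Godement–Jacquet, whose test functions `F = Φ |det|^s` (`Φ ∈ 𝒮(M_n(𝔸))` restricted to `GL_n(𝔸)`)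
are integrable but neither continuous of compact support nor bounded away from the singular
matrices (Godement–Jacquet, LNM 260, §12; Jacquet, *Principal L-functions of the linear group*,
Corvallis (1979), §4). Setting: `H ≤ G` closed in a locally compact second countable group, `ρ` left
invariant on `H`, `μ` a `G`-invariant measure on `G ⧸ H`, `ν` an inversion-invariant Haar measure,
`c = unfoldingConstant H ρ μ ν` (`Literature.MeasureTheory.Group.InvariantQuotientUnfolding`).

* `lintegral_comp_mul_inv_mul_comp_mk` — the substitution `g ↦ x̃ g⁻¹`, `ℝ≥0∞`-valued.
* `ae_integrable_comp_mul_inv_smul` — **for `F ∈ L¹(G)` and `φ ∈ L¹(G ⧸ H)` the lifted integrand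
  `g ↦ F(x̃ g⁻¹) φ(gH)` is `ν`-integrable for `μ`-a.e. coset `x̃H` and every lift** (Tonelli:
  `∫∫ |F(x̃ g⁻¹)| |φ(gH)| dν dμ = ‖F‖₁ ‖φ‖₁`).
* `ae_smul_orbitalSmoothing_eq_integral_cosetKernel_smul` — **the kernel formula for `F ∈ L¹(G)`**:
  for `μ`-a.e. `x` and every lift `x̃`, `c • (S_F φ)(x) = ∫ K_F(x̃, y) • φ(y) dμ(y)`,
  `S_F φ (x) = ∫_G F(g) φ(g⁻¹ • x) dν(g)` (`orbitalSmoothing`).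
* `integral_mul_integral_mul_comp_smul_eq` — **Fubini for the bilinear form**: for `F ∈ L¹(G)` and
  `φ, ψ ∈ L²(G ⧸ H)`, `∫_G F(g) (∫ ψ(x) φ(g⁻¹ • x) dμ) dν = ∫ ψ(x) (S_F φ)(x) dμ` (with
  `ψ = conj φ'` the left side is `∫ F(g) ⟨φ', R(g) φ⟩ dg`);
  `integral_mul_integral_mul_comp_smul_eq_inv_mul_integral_cosetKernel` — **the unfolded form**
  `= c⁻¹ ∫ ψ(x) (∫ K_F(x̃, y) φ(y) dμ(y)) dμ(x)`.

Everything is proved; no named facts.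

## References

* S. Gelbart, *Automorphic forms on adele groups* (1975), (9.7), (9.20) [Gelbart1975].
* R. Godement, H. Jacquet, *Zeta functions of simple algebras*, LNM 260 (1972), §10, §12
  [GodementJacquetLNM260].
* G. B. Folland, *A Course in Abstract Harmonic Analysis* (1995), Thm. 2.49 [Folland1995].
-/

noncomputable section

open MeasureTheory Measure Set Filter Topology
open Literature.MeasureTheory.Group
open scoped ENNReal NNReal Pointwise ComplexConjugate

namespace Literature.NumberTheory.Automorphic

-- the coset space carries the Borel σ-algebra supplied by the user, not the quotient σ-algebra
attribute [-instance] Quotient.instMeasurableSpace QuotientGroup.measurableSpace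

/-! ### The substitution `g ↦ x̃ g⁻¹` for `ℝ≥0∞`-valued integrands -/

section Substitution

variable {G : Type*} [Group G] [MeasurableSpace G] [MeasurableMul G] [MeasurableInv G]
  (H : Subgroup G) (ν : Measure G) [ν.IsMulLeftInvariant] [ν.IsInvInvariant]

/-- **The substitution `g ↦ x̃ g⁻¹`, `ℝ≥0∞`-valued**: for `ν` left invariant and inversion invariant,
`∫⁻ F(x̃ g⁻¹) Ψ(gH) dν(g) = ∫⁻ F(g) Ψ(g⁻¹ • x̃H) dν(g)` (as `orbitalSmoothing_mk_eq_integral`).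
[folklore] -/
theorem lintegral_comp_mul_inv_mul_comp_mk (F : G → ℝ≥0∞) (Ψ : G ⧸ H → ℝ≥0∞) (x₀ : G) :
    ∫⁻ g, F (x₀ * g⁻¹) * Ψ (QuotientGroup.mk g) ∂ν =
      ∫⁻ g, F g * Ψ (g⁻¹ • (QuotientGroup.mk x₀ : G ⧸ H)) ∂ν := by
  have h1 : (fun g : G => F g * Ψ (g⁻¹ • (QuotientGroup.mk x₀ : G ⧸ H))) =
      fun g : G => (fun u : G => F (x₀ * u⁻¹) * Ψ (QuotientGroup.mk u)) ((x₀⁻¹ * g)⁻¹) := by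
    funext g
    simp only [mul_inv_rev, inv_inv, mul_inv_cancel_left]
    rfl
  rw [h1, lintegral_mul_left_eq_self (fun g : G => (fun u : G => F (x₀ * u⁻¹) *
      Ψ (QuotientGroup.mk u)) g⁻¹) x₀⁻¹]
  exact (lintegral_inv_eq_self (μ := ν) (fun u : G => F (x₀ * u⁻¹) * Ψ (QuotientGroup.mk u))).symm

end Substitution

/-! ### `R(F)` for `F ∈ L¹(G)`: a.e. integrability of the lifted integrand and the kernel formula -/

section Unfolding

variable {G : Type*} [Group G] [TopologicalSpace G] [IsTopologicalGroup G] [LocallyCompactSpace G]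
  [SecondCountableTopology G] [T2Space G] [MeasurableSpace G] [BorelSpace G]
  (H : Subgroup G) [hH : IsClosed (H : Set G)]
  (ρ : Measure H) [ρ.IsMulLeftInvariant] [SFinite ρ] [IsFiniteMeasureOnCompacts ρ]
  [MeasurableSpace (G ⧸ H)] [BorelSpace (G ⧸ H)]
  (μ : Measure (G ⧸ H)) [SMulInvariantMeasure G (G ⧸ H) μ] [IsFiniteMeasureOnCompacts μ] [SFinite μ]
  (ν : Measure G) [IsHaarMeasure ν] [ν.IsInvInvariant]
  {𝕜 : Type*} [RCLike 𝕜] {E' : Type*} [NormedAddCommGroup E'] [NormedSpace 𝕜 E']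
  [NormedSpace ℝ E'] [CompleteSpace E']

omit hH [SFinite ρ] [IsFiniteMeasureOnCompacts ρ] [ρ.IsMulLeftInvariant] [T2Space G]
  [IsFiniteMeasureOnCompacts μ] [NormedSpace ℝ E'] [CompleteSpace E'] in
/-- **The lifted integrand `g ↦ F(x̃ g⁻¹) φ(gH)` is integrable for a.e. coset and every lift.**
For `F ∈ L¹(G, ν)` and `φ ∈ L¹(G ⧸ H, μ)` strongly measurable:
`∫_{G ⧸ H} ∫_G |F(x̃ g⁻¹)| |φ(gH)| dν(g) dμ(x̃H) = ∫_G |F(g)| ∫_{G ⧸ H} |φ(g⁻¹ x)| dμ(x) dν(g)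
= ‖F‖₁ ‖φ‖₁ < ∞` (substitution `g ↦ x̃ g⁻¹`, Tonelli, invariance of `μ`), so the inner integral is
finite for `μ`-a.e. `x̃H`. [folklore] -/
theorem ae_integrable_comp_mul_inv_smul {F : G → 𝕜} (hF : Integrable F ν)
    {φ : G ⧸ H → E'} (hφm : StronglyMeasurable φ) (hφ : Integrable φ μ) :
    ∀ᵐ x ∂μ, ∀ x₀ : G, QuotientGroup.mk x₀ = x →
      Integrable (fun g : G => F (x₀ * g⁻¹) • φ (QuotientGroup.mk g)) ν := by
  -- the descended majorant
  set Λ : G ⧸ H → ℝ≥0∞ := fun x => ∫⁻ g, ‖F g‖ₑ * ‖φ (g⁻¹ • x)‖ₑ ∂ν with hΛ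
  have hact : Measurable fun p : G × (G ⧸ H) => p.1⁻¹ • p.2 :=
    (continuous_fst.inv.smul continuous_snd).measurable
  have hint : AEMeasurable (Function.uncurry fun (g : G) (x : G ⧸ H) => ‖F g‖ₑ * ‖φ (g⁻¹ • x)‖ₑ)
      (ν.prod μ) := by
    refine AEMeasurable.mul (f := fun p : G × (G ⧸ H) => ‖F p.1‖ₑ)
      (g := fun p : G × (G ⧸ H) => ‖φ (p.1⁻¹ • p.2)‖ₑ) ?_ ?_
    · exact (hF.1.aemeasurable.enorm).comp_quasiMeasurePreserving
        (Measure.quasiMeasurePreserving_fst (μ := ν) (ν := μ))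
    · exact (hφm.enorm.comp hact).aemeasurable
  have hΛm : AEMeasurable Λ μ := hint.lintegral_prod_left'
  -- Tonelli and invariance: `∫ Λ dμ = ‖F‖₁ ‖φ‖₁`
  have hφg : ∀ g : G, Measurable fun x : G ⧸ H => ‖φ (g⁻¹ • x)‖ₑ := fun g =>
    hφm.enorm.comp (measurable_const_smul _)
  have hΛint : ∫⁻ x, Λ x ∂μ = (∫⁻ g, ‖F g‖ₑ ∂ν) * ∫⁻ x, ‖φ x‖ₑ ∂μ := by
    have hswap := lintegral_lintegral_swap hint
    change ∫⁻ x, ∫⁻ g, ‖F g‖ₑ * ‖φ (g⁻¹ • x)‖ₑ ∂ν ∂μ = _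
    rw [← hswap]
    have hinv : ∀ g : G, ∫⁻ x, ‖φ (g⁻¹ • x)‖ₑ ∂μ = ∫⁻ x, ‖φ x‖ₑ ∂μ := fun g =>
      (measurePreserving_smul g⁻¹ μ).lintegral_comp hφm.enorm
    have h2 : ∀ g : G, ∫⁻ x, ‖F g‖ₑ * ‖φ (g⁻¹ • x)‖ₑ ∂μ = ‖F g‖ₑ * ∫⁻ x, ‖φ x‖ₑ ∂μ := fun g => by
      rw [lintegral_const_mul _ (hφg g), hinv g]
    simp_rw [h2]
    rw [lintegral_mul_const'' _ hF.1.aemeasurable.enorm]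
  have hfin : ∫⁻ x, Λ x ∂μ < ∞ := by
    rw [hΛint]
    exact ENNReal.mul_lt_top hF.2 hφ.2
  have hae : ∀ᵐ x ∂μ, Λ x < ∞ := ae_lt_top' hΛm hfin.ne
  filter_upwards [hae] with x hx x₀ hx₀
  refine ⟨?_, ?_⟩
  · have hmp : MeasurePreserving (fun g : G => x₀ * g⁻¹) ν ν :=
      (measurePreserving_mul_left ν x₀).comp (Measure.measurePreserving_inv ν)
    exact (hF.1.comp_measurePreserving hmp).smul
      ((hφm.comp_measurable (QuotientGroup.continuous_mk (N := H)).measurable).aestronglyMeasurable)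
  · change ∫⁻ g, ‖F (x₀ * g⁻¹) • φ (QuotientGroup.mk g)‖ₑ ∂ν < ∞
    calc ∫⁻ g, ‖F (x₀ * g⁻¹) • φ (QuotientGroup.mk g)‖ₑ ∂ν
        = ∫⁻ g, ‖F (x₀ * g⁻¹)‖ₑ * ‖φ (QuotientGroup.mk g)‖ₑ ∂ν := by simp_rw [enorm_smul]
      _ = ∫⁻ g, ‖F g‖ₑ * ‖φ (g⁻¹ • (QuotientGroup.mk x₀ : G ⧸ H))‖ₑ ∂ν :=
          lintegral_comp_mul_inv_mul_comp_mk H ν (fun g => ‖F g‖ₑ) (fun y => ‖φ y‖ₑ) x₀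
      _ = Λ x := by rw [hx₀]
      _ < ∞ := hx

/-- **`R(F)` is an integral operator with kernel `c⁻¹ K_F`, for `F ∈ L¹(G)`** (the kernel formula
`smul_orbitalSmoothing_mk_eq_integral_cosetKernel_smul` of `AutomorphicQuotientKernel`, there for
`F ∈ C_c(G)`, here for integrable `F`, valid for `μ`-a.e. coset and every lift of it): for
`F ∈ L¹(G, ν)` (`ν` an inversion-invariant Haar measure) and `φ ∈ L¹(G ⧸ H, μ)` strongly measurable,
for `μ`-a.e. `x` and every `x̃` over `x`,
`c • ∫_G F(g) φ(g⁻¹ • x) dν(g) = ∫_{G ⧸ H} K_F(x̃, y) • φ(y) dμ(y)`,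
`K_F(x̃, ỹH) = ∫_H F(x̃ h⁻¹ ỹ⁻¹) dρ(h)` (`cosetKernel`). (Gelbart (1975), (9.7), (9.20);
Godement–Jacquet, LNM 260, §10, the kernels attached to `Φ ∈ 𝒮(M_n(𝔸))`, which are integrable but
not compactly supported on `GL_n(𝔸)`.) [folklore] -/
theorem ae_smul_orbitalSmoothing_eq_integral_cosetKernel_smul {F : G → 𝕜} (hF : Integrable F ν)
    {φ : G ⧸ H → E'} (hφm : StronglyMeasurable φ) (hφ : Integrable φ μ) :
    ∀ᵐ x ∂μ, ∀ x₀ : G, QuotientGroup.mk x₀ = x →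
      (unfoldingConstant H ρ μ ν) • orbitalSmoothing ν F φ x =
        ∫ y, cosetKernel H ρ F x₀ y • φ y ∂μ := by
  filter_upwards [ae_integrable_comp_mul_inv_smul H μ ν hF hφm hφ] with x hx x₀ hx₀
  have hFi := hx x₀ hx₀
  rw [← hx₀, orbitalSmoothing_mk_eq_integral H ν F φ x₀]
  change (unfoldingConstant H ρ μ ν) •
    ∫ g, (fun g : G => F (x₀ * g⁻¹) • φ (QuotientGroup.mk g)) g ∂ν = _
  rw [← integral_fiberIntegralVec_eq_smul_integral H ρ μ ν hFi]
  refine integral_congr_ae (Eventually.of_forall fun y => ?_)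
  induction y using QuotientGroup.induction_on with
  | H y₀ =>
    beta_reduce
    rw [fiberIntegralVec_mk, cosetKernel, fiberIntegralVec_mk]
    exact integral_subgroup_smul_comp_mk H ρ (fun g => F (x₀ * g⁻¹)) φ y₀

/-- `2 |a| |b| ≤ |a|² + |b|²` in the form used for products of `L²` functions. [folklore] -/
theorem norm_mul_le_half_add_sq (a b : 𝕜) : ‖a * b‖ ≤ (‖a‖ ^ 2 + ‖b‖ ^ 2) / 2 := by
  rw [norm_mul]
  nlinarith [sq_nonneg (‖a‖ - ‖b‖), norm_nonneg a, norm_nonneg b]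

omit hH [SFinite ρ] [IsFiniteMeasureOnCompacts ρ] [ρ.IsMulLeftInvariant] [T2Space G]
  [IsFiniteMeasureOnCompacts μ] [LocallyCompactSpace G] [SecondCountableTopology G] [SFinite μ] in
/-- A translate of an `L²` function on `G ⧸ H` times an `L²` function is integrable, with the
uniform bound `∫ |ψ| |φ(g⁻¹ ·)| ≤ (‖ψ‖₂² + ‖φ‖₂²)/2` (invariance of `μ`). [folklore] -/
theorem integrable_mul_comp_smul_and_integral_le {φ ψ : G ⧸ H → 𝕜}
    (hφm : StronglyMeasurable φ) (hφ : MemLp φ 2 μ) (hψm : StronglyMeasurable ψ) (hψ : MemLp ψ 2 μ)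
    (g : G) :
    Integrable (fun x => ψ x * φ (g⁻¹ • x)) μ ∧
      ∫ x, ‖ψ x * φ (g⁻¹ • x)‖ ∂μ ≤ ((∫ x, ‖ψ x‖ ^ 2 ∂μ) + ∫ x, ‖φ x‖ ^ 2 ∂μ) / 2 := by
  have hψ2 : Integrable (fun x => ‖ψ x‖ ^ 2) μ := (memLp_two_iff_integrable_sq_norm hψ.1).1 hψ
  have hφ2 : Integrable (fun x => ‖φ x‖ ^ 2) μ := (memLp_two_iff_integrable_sq_norm hφ.1).1 hφ
  have hmp := measurePreserving_smul g⁻¹ μ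
  have hφg2 : Integrable (fun x => ‖φ (g⁻¹ • x)‖ ^ 2) μ :=
    (hmp.integrable_comp hφ2.aestronglyMeasurable).2 hφ2
  have hφgint : ∫ x, ‖φ (g⁻¹ • x)‖ ^ 2 ∂μ = ∫ x, ‖φ x‖ ^ 2 ∂μ :=
    hmp.integral_comp (measurableEmbedding_const_smul _) (fun x => ‖φ x‖ ^ 2)
  have hmeas : AEStronglyMeasurable (fun x => ψ x * φ (g⁻¹ • x)) μ :=
    (hψm.mul (hφm.comp_measurable (measurable_const_smul _))).aestronglyMeasurable
  have hbound : ∀ x, ‖ψ x * φ (g⁻¹ • x)‖ ≤ (‖ψ x‖ ^ 2 + ‖φ (g⁻¹ • x)‖ ^ 2) / 2 := fun x =>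
    norm_mul_le_half_add_sq _ _
  have hdom : Integrable (fun x => (‖ψ x‖ ^ 2 + ‖φ (g⁻¹ • x)‖ ^ 2) / 2) μ := (hψ2.add hφg2).div_const 2
  refine ⟨hdom.mono' hmeas (Eventually.of_forall hbound), ?_⟩
  calc ∫ x, ‖ψ x * φ (g⁻¹ • x)‖ ∂μ ≤ ∫ x, (‖ψ x‖ ^ 2 + ‖φ (g⁻¹ • x)‖ ^ 2) / 2 ∂μ :=
        integral_mono_of_nonneg (Eventually.of_forall fun _ => norm_nonneg _) hdom
          (Eventually.of_forall hbound)
    _ = ((∫ x, ‖ψ x‖ ^ 2 ∂μ) + ∫ x, ‖φ x‖ ^ 2 ∂μ) / 2 := by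
        rw [integral_div, integral_add hψ2 hφg2, hφgint]

omit hH [SFinite ρ] [IsFiniteMeasureOnCompacts ρ] [ρ.IsMulLeftInvariant] [T2Space G]
  [IsFiniteMeasureOnCompacts μ] [ν.IsInvInvariant] in
/-- **Unfolding the bilinear form `∫_G F(g) ⟨ψ̄, R(g) φ⟩ dg` (Fubini)**: for `F ∈ L¹(G, ν)` and
`φ, ψ ∈ L²(G ⧸ H, μ)` strongly measurable,
`∫_G F(g) (∫_{G ⧸ H} ψ(x) φ(g⁻¹ • x) dμ(x)) dν(g) = ∫_{G ⧸ H} ψ(x) (S_F φ)(x) dμ(x)`,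
`S_F φ (x) = ∫_G F(g) φ(g⁻¹ • x) dν(g)` the orbital smoothing (the integrand being absolutely
integrable on `G × (G ⧸ H)`: `∫_G |F| ∫ |ψ| |φ(g⁻¹ ·)| ≤ ‖F‖₁ (‖ψ‖₂² + ‖φ‖₂²)/2`). With `ψ = conj φ'`
the left-hand side is `∫ F(g) ⟨φ', R(g) φ⟩ dg`, the global zeta integrals of Godement–Jacquet
(LNM 260, §12) with `F = Φ |det|^s`. [folklore] -/
theorem integral_mul_integral_mul_comp_smul_eq {F : G → 𝕜} (hF : Integrable F ν) {φ ψ : G ⧸ H → 𝕜}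
    (hφm : StronglyMeasurable φ) (hφ : MemLp φ 2 μ) (hψm : StronglyMeasurable ψ) (hψ : MemLp ψ 2 μ) :
    ∫ g, F g * (∫ x, ψ x * φ (g⁻¹ • x) ∂μ) ∂ν = ∫ x, ψ x * orbitalSmoothing ν F φ x ∂μ := by
  set f : G → (G ⧸ H) → 𝕜 := fun g x => F g * (ψ x * φ (g⁻¹ • x)) with hf
  have hact : Measurable fun p : G × (G ⧸ H) => p.1⁻¹ • p.2 :=
    (continuous_fst.inv.smul continuous_snd).measurable
  have hfm : AEStronglyMeasurable (Function.uncurry f) (ν.prod μ) := by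
    refine AEStronglyMeasurable.mul ?_ ?_
    · exact hF.1.comp_quasiMeasurePreserving (Measure.quasiMeasurePreserving_fst (μ := ν) (ν := μ))
    · exact ((hψm.comp_measurable measurable_snd).mul (hφm.comp_measurable hact)).aestronglyMeasurable
  set M : ℝ := ((∫ x, ‖ψ x‖ ^ 2 ∂μ) + ∫ x, ‖φ x‖ ^ 2 ∂μ) / 2 with hM
  have hfi : Integrable (Function.uncurry f) (ν.prod μ) := by
    rw [integrable_prod_iff hfm]
    constructor
    · refine Eventually.of_forall fun g => ?_
      exact ((integrable_mul_comp_smul_and_integral_le H μ hφm hφ hψm hψ g).1).const_mul (F g)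
    · have hb : ∀ g, ∫ x, ‖Function.uncurry f (g, x)‖ ∂μ ≤ ‖F g‖ * M := fun g => by
        have h1 : (fun x => ‖Function.uncurry f (g, x)‖) = fun x => ‖F g‖ * ‖ψ x * φ (g⁻¹ • x)‖ := by
          funext x
          simp [hf, norm_mul]
        rw [h1, integral_const_mul]
        exact mul_le_mul_of_nonneg_left
          (integrable_mul_comp_smul_and_integral_le H μ hφm hφ hψm hψ g).2 (norm_nonneg _)
      refine (hF.norm.mul_const M).mono' hfm.norm.integral_prod_right' (Eventually.of_forall fun g => ?_)
      rw [Real.norm_of_nonneg (integral_nonneg fun _ => norm_nonneg _)]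
      exact hb g
  have hswap := integral_integral_swap hfi
  have hL : ∫ g, ∫ x, f g x ∂μ ∂ν = ∫ g, F g * (∫ x, ψ x * φ (g⁻¹ • x) ∂μ) ∂ν := by
    refine integral_congr_ae (Eventually.of_forall fun g => ?_)
    simp only [hf]
    exact integral_const_mul _ _
  have hR : ∫ x, ∫ g, f g x ∂ν ∂μ = ∫ x, ψ x * orbitalSmoothing ν F φ x ∂μ := by
    refine integral_congr_ae (Eventually.of_forall fun x => ?_)
    simp only [hf, orbitalSmoothing, smul_eq_mul]
    rw [← integral_const_mul]
    refine integral_congr_ae (Eventually.of_forall fun g => ?_)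
    ring
  rw [← hL, hswap, hR]

/-- **The unfolded bilinear form**: for `c = unfoldingConstant H ρ μ ν ≠ 0`, `F ∈ L¹(G, ν)`,
`φ ∈ L¹ ∩ L²(G ⧸ H, μ)` and `ψ ∈ L²(G ⧸ H, μ)` strongly measurable,
`∫_G F(g) (∫ ψ(x) φ(g⁻¹ • x) dμ(x)) dν(g) = c⁻¹ ∫ ψ(x) (∫ K_F(x̃, y) φ(y) dμ(y)) dμ(x)` with the
lift `x̃ = Quotient.out x` (any lift gives the same inner integral for a.e. `x`,
`ae_smul_orbitalSmoothing_eq_integral_cosetKernel_smul`). This is the first step ("unfolding") of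
the analytic continuation of the global zeta integrals of Godement–Jacquet (LNM 260, §12, the
kernels `K_Φ(h, g) = Σ_ξ Φ(h⁻¹ ξ g)` after the further unfolding of `H = A_G GL_n(K)`).
[folklore] -/
theorem integral_mul_integral_mul_comp_smul_eq_inv_mul_integral_cosetKernel
    (hc : unfoldingConstant H ρ μ ν ≠ 0) {F : G → 𝕜} (hF : Integrable F ν) {φ ψ : G ⧸ H → 𝕜}
    (hφm : StronglyMeasurable φ) (hφ : MemLp φ 2 μ) (hφ1 : Integrable φ μ)
    (hψm : StronglyMeasurable ψ) (hψ : MemLp ψ 2 μ) :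
    ∫ g, F g * (∫ x, ψ x * φ (g⁻¹ • x) ∂μ) ∂ν =
      ((unfoldingConstant H ρ μ ν : ℝ)⁻¹ : 𝕜) *
        ∫ x, ψ x * (∫ y, cosetKernel H ρ F (Quotient.out x) y * φ y ∂μ) ∂μ := by
  rw [integral_mul_integral_mul_comp_smul_eq H μ ν hF hφm hφ hψm hψ, ← integral_const_mul]
  refine integral_congr_ae ?_
  filter_upwards [ae_smul_orbitalSmoothing_eq_integral_cosetKernel_smul H ρ μ ν hF hφm hφ1] with x hx
  have h := hx (Quotient.out x) (QuotientGroup.out_eq' x)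
  simp only [smul_eq_mul] at h
  -- `c • S = ∫ K φ` gives `S = c⁻¹ ∫ K φ`
  have hS : orbitalSmoothing ν F φ x =
      ((unfoldingConstant H ρ μ ν : ℝ)⁻¹ : 𝕜) * ∫ y, cosetKernel H ρ F (Quotient.out x) y * φ y ∂μ := by
    rw [← h, NNReal.smul_def, RCLike.real_smul_eq_coe_mul, ← mul_assoc]
    have hc' : ((unfoldingConstant H ρ μ ν : ℝ) : 𝕜) ≠ 0 := by exact_mod_cast hc
    rw [inv_mul_cancel₀ hc', one_mul]
  rw [hS]
  ring

end Unfolding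

end Literature.NumberTheory.Automorphic
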